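import Summits.QuantumFields.BalabanUV.T4Continuum.Support.NE3CovLiftCurl
import Summits.QuantumFields.BalabanUV.T4Continuum.Support.NE3HessForm
import HarnessLib

/-!
# NE7DcurlGaugeCovariance — GAUGE AND TRANSLATION COVARIANCE OF `dcurlAt` (the derivative of the dressed curl, the kernel of the cubic vertex `𝒬_W(A) = dcurlAt W A A`):
# `dcurlAt (W^u) (X^u) (Y^u) (z;μ,ν) = Ad_{u z} (dcurlAt W X Y (z;μ,ν))` and `dcurlAt W_t X_t Y_t z = dcurlAt W X Y (z − t)` — the two structural bricks of the
# local-gauge argument for the curved twin of F46 (CURVED-APE-ROAD (L5))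

Cell `pub-balaban`, rung (B)+1 sub-cell t4, lineage `b2b-balaban-t4-ne7-p1` (CRUX PROVER NE7 #1 = OWNER of row NE7), generation 75.  File F62, over row NE3's
`NE3CovLiftCurl.curlAt_gaugeAct` (covariance of the dressed curl), `AveragingDeficitLocality.gaugeAct_vary` (the gauge action intertwines the perturbations) and
`NE3HessForm.hasDerivAt_curlAt_vary` (`dcurlAt` IS the derivative).

WHY.  The strong curved expansion letter (memo `t4/b2b-balaban-t4-ne7-p1-g75/CURVED-APE-ROAD.md` (L5)) needs the COVARIANT adjacent differences of
`𝒬_W(A) = dcurlAt W A A` (the hypothesis of F61 `NE7CovariantByParts.abs_sum_nReTr_curlAt_mul_le_W`).  F46 proved the flat case by TRANSLATION covariance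
(`dcurlAt_flat_shift`) and bilinearity; at a curved background the plain lattice differences of `W`'s links and of `A` are not small — only the covariant
ones are — so the curved twin runs F46's argument in a LOCAL GAUGE around the two plaquettes (where `W ≈ 1` up to the plaquette radius), which requires
(i) gauge covariance of `dcurlAt` — §1 here — and (ii) translation covariance at a general background — §2 here.

WHAT ([folklore] lattice calculus; 0 def, 0 sorry).
§1 **`dcurlAt_gaugeAct`** — `dcurlAt (gaugeAct u W) (dirGauge u X) (dirGauge u Y) z μ ν = Ad (u z) (dcurlAt W X Y z μ ν)` for ANY `u, W, X, Y` (uniqueness of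
   derivatives: both sides are `d/dt|₀` of `curlAt ((We^{tX})^u) (Y^u) = Ad_{u z} curlAt (We^{tX}) Y`).
§2 **`dcurlAt_shift`** — `dcurlAt (W(· − t)) (X(· − t)) (Y(· − t)) z μ ν = dcurlAt W X Y (z − t) μ ν` (F46's `dcurlAt_flat_shift` at a general background).
§3 `norm_dcurlAt_gaugeAct` — for unitary `u`: `‖dcurlAt (W^u) (X^u) (Y^u) p′‖ = ‖dcurlAt W X Y p′‖`.
HONEST FRAMING (page 1): structural identities on OUR lattice objects; nothing of Bałaban's asserted; (APE) on curved data NOT proved; NOT ONE-STEP, NOT NE7; spine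
0∕9; finite T⁴ rung (B)+1 — NOT infinite volume, NOT mass gap, NOT `BetaPertH`, NOT Clay.  Continuum YM on T⁴ ⇐ BetaPertH ∧ nine spine estimates (0/9 proved);
BetaPertH ⇐ (D1) ∧ (D4) ∧ CAP+tail; G-an2-4 gates asym, D1 and NE2/3/4.
-/

set_option autoImplicit false

open scoped BigOperators Matrix.Norms.L2Operator
open NormedSpace Finset Set

namespace Summit.QuantumFields.BalabanUV.T4Continuum.NE7DcurlGaugeCovariance

open Literature.MathematicalPhysics.QuantumFieldTheory.Balaban1983to89
open B7Prop1Explicit B7Prop2Explicit MatrixLog UnitaryModel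
open T4AveragingDeficitWall (Ad IsUnitaryCfg curlAt vary)
open AveragingDeficitTransport (norm_Ad_of_unitary)
open AveragingDeficitLocality (dirGauge gaugeAct_vary)
open NE3EnergyShapes (IsUnitarySite)
open NE3HessForm (dcurlAt hasDerivAt_curlAt_vary)
open NE3CovLiftCurl (curlAt_gaugeAct)

noncomputable section

variable {d : ℕ} {n : Type*} [Fintype n] [DecidableEq n]

/-! ## §1 Gauge covariance -/

/-- **GAUGE COVARIANCE OF `dcurlAt`**: `dcurlAt (W^u) (X^u) (Y^u) (z;μ,ν) = Ad_{u z} (dcurlAt W X Y (z;μ,ν))` (directions dressed at their endpoints,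
`dirGauge`). [folklore] -/
theorem dcurlAt_gaugeAct (u : Site d → (Matrix n n ℂ)ˣ) (W : Site d → Fin d → (Matrix n n ℂ)ˣ) (X Y : Site d → Fin d → Matrix n n ℂ)
    (z : Site d) (μ ν : Fin d) :
    dcurlAt (gaugeAct u W) (dirGauge u X) (dirGauge u Y) z μ ν = Ad (u z) (dcurlAt W X Y z μ ν) := by
  have h1 := hasDerivAt_curlAt_vary (gaugeAct u W) (dirGauge u X) (dirGauge u Y) z μ ν
  have hfun : (fun t : ℝ => curlAt (vary (gaugeAct u W) (dirGauge u X) t) (dirGauge u Y) z μ ν)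
      = fun t : ℝ => Ad (u z) (curlAt (vary W X t) Y z μ ν) := by
    funext t
    rw [← gaugeAct_vary, curlAt_gaugeAct]
  rw [hfun] at h1
  have h2 : HasDerivAt (fun t : ℝ => Ad (u z) (curlAt (vary W X t) Y z μ ν)) (Ad (u z) (dcurlAt W X Y z μ ν)) 0 := by
    have h := ((hasDerivAt_curlAt_vary W X Y z μ ν).const_mul ((u z : (Matrix n n ℂ)ˣ) : Matrix n n ℂ)).mul_const
      (((u z)⁻¹ : (Matrix n n ℂ)ˣ) : Matrix n n ℂ)
    simpa only [Ad] using h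
  exact h1.unique h2

/-- For unitary `u` the gauged `dcurlAt` has the same norm. [folklore] -/
theorem norm_dcurlAt_gaugeAct {u : Site d → (Matrix n n ℂ)ˣ} (hu : IsUnitarySite u) (W : Site d → Fin d → (Matrix n n ℂ)ˣ)
    (X Y : Site d → Fin d → Matrix n n ℂ) (z : Site d) (μ ν : Fin d) :
    ‖dcurlAt (gaugeAct u W) (dirGauge u X) (dirGauge u Y) z μ ν‖ = ‖dcurlAt W X Y z μ ν‖ := by
  rw [dcurlAt_gaugeAct, norm_Ad_of_unitary (hu z)]

/-! ## §2 Translation covariance at a general background -/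

/-- **TRANSLATION COVARIANCE OF `dcurlAt`**: translating the background and both direction fields by `t` translates the plaquette. [folklore] -/
theorem dcurlAt_shift (W : Site d → Fin d → (Matrix n n ℂ)ˣ) (X Y : Site d → Fin d → Matrix n n ℂ) (t z : Site d) (μ ν : Fin d) :
    dcurlAt (fun y κ => W (y - t) κ) (fun y κ => X (y - t) κ) (fun y κ => Y (y - t) κ) z μ ν = dcurlAt W X Y (z - t) μ ν := by
  simp only [dcurlAt, add_sub_right_comm]

/-- The same for the dressed curl. [folklore] -/
theorem curlAt_shift (W : Site d → Fin d → (Matrix n n ℂ)ˣ) (Y : Site d → Fin d → Matrix n n ℂ) (t z : Site d) (μ ν : Fin d) :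
    curlAt (fun y κ => W (y - t) κ) (fun y κ => Y (y - t) κ) z μ ν = curlAt W Y (z - t) μ ν := by
  simp only [curlAt, add_sub_right_comm]

end

end Summit.QuantumFields.BalabanUV.T4Continuum.NE7DcurlGaugeCovariance
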